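import Literature.Analysis.FluidPDE.ClassicalSolutionGlue
import HarnessLib

/-!
# Gluing classical Navier–Stokes solutions on overlapping closed slabs

Analysis/FluidPDE support file (theorems only; no definitions, no named facts, no `sorry`),
companion of `ClassicalSolutionGlue.lean` (gluing along an OPEN overlap of a half-open slab,
velocities only, pressures renormalised at the origin) and whole-space twin of the accepted torus
lemmas `Literature.Analysis.FluidPDE.Torus.isSmoothSpaceTimeOn_glue`,
`…timeDerivWithin_glue_left/right` (`EulerTorusContinuation.lean`) and
`Literature.Analysis.FunctionSpaces.Torus.IsClassicalNSSolutionOn.glue_Icc`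
(`TorusClassicalNSPerturbedRestart.lean`): two classical solutions
`Literature.Analysis.FluidPDE.IsClassicalNSSolutionOn` (Fefferman (1), (2), (6); jointly `C^∞`
velocity and pressure, momentum equation with the one-sided time derivative within the time set)
given on CLOSED slabs `[a, b] × E` and `[a', b'] × E`, `a ≤ a' < b ≤ b'`, which agree — velocity AND
pressure — on the open overlap `(a', b)`, glue (switching at any `m ∈ (a', b)`) to a classical
solution on `[a, b'] × E` (Beale–Kato–Majda 1984, §1: continuation "in the class" to a larger
interval). Joint smoothness is local in time (`isSmoothSpaceTimeOn_glue_Icc`); the one-sided time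
derivatives within `[a, b']` are those within `[a, b]` at times `< b` and those within `[a', b']`
at times `> a'` (`timeDerivWithin_glue_left_Icc`, `timeDerivWithin_glue_right_Icc`). Used by the
cell `ns-blowup` to glue an unforced continuation of a translated registered stage back onto the
forced stage (`Summits/…/FluidComputer/PalasekTowerRegisterGlobalEnvelope.lean`).

All statements are folklore bookkeeping; no analysis beyond `derivWithin` congruences is used.

## References

* J. T. Beale, T. Kato, A. Majda, *Remarks on the breakdown of smooth solutions for the 3-D
  Euler equations*, Comm. Math. Phys. 94 (1984), §1 (continuation in the class to a larger
  interval). [BealeKatoMajda1984]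
* C. L. Fefferman, *Existence and smoothness of the Navier–Stokes equation* (Clay, 2000/2006),
  (1), (2), (6).
-/

noncomputable section

open Set Function Filter Topology
open scoped ContDiff

namespace Literature.Analysis.FluidPDE

section Glue

variable {X F : Type*} [NormedAddCommGroup X] [NormedSpace ℝ X] [NormedAddCommGroup F]
  [NormedSpace ℝ F]

omit [NormedAddCommGroup X] [NormedSpace ℝ X] in
/-- Local-in-time smoothness transfers to a glued field: if `U` agrees with a field smooth on
`[a, b] × X` at times `< b` and with a field smooth on `[a', b'] × X` at times `> a'`, where
`a' < b`, then `U` is smooth on `[a, b'] × X` (joint smoothness is local; the two pieces are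
relatively open). Whole-space twin of `FluidPDE.Torus.isSmoothSpaceTimeOn_glue`.
[cite: BealeKatoMajda1984, §1] -/
theorem isSmoothSpaceTimeOn_glue_Icc [NormedAddCommGroup X] [NormedSpace ℝ X] {a b a' b' : ℝ}
    {U v₁ v₂ : ℝ → X → F}
    (hv₁ : IsSmoothSpaceTimeOn (Icc a b) v₁) (hv₂ : IsSmoothSpaceTimeOn (Icc a' b') v₂)
    (ha'b : a' < b) (h₁ : ∀ t ∈ Icc a b', t < b → U t = v₁ t)
    (h₂ : ∀ t ∈ Icc a b', a' < t → U t = v₂ t) : IsSmoothSpaceTimeOn (Icc a b') U := by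
  refine contDiffOn_of_locally_contDiffOn fun z hz => ?_
  obtain ⟨t, y⟩ := z
  have ht : t ∈ Icc a b' := (mem_prod.1 hz).1
  by_cases htb : t < b
  · refine ⟨Iio b ×ˢ univ, isOpen_Iio.prod isOpen_univ, ⟨htb, mem_univ _⟩, ?_⟩
    rw [prod_inter_prod, univ_inter]
    have hsub : Icc a b' ∩ Iio b ⊆ Icc a b := fun s hs => ⟨hs.1.1, le_of_lt hs.2⟩
    refine (hv₁.mono hsub).congr fun z hz => ?_
    obtain ⟨s, w⟩ := z
    have hs : s ∈ Icc a b' ∩ Iio b := (mem_prod.1 hz).1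
    simp only [uncurry_apply_pair, h₁ s hs.1 hs.2]
  · have hta' : a' < t := ha'b.trans_le (not_lt.1 htb)
    refine ⟨Ioi a' ×ˢ univ, isOpen_Ioi.prod isOpen_univ, ⟨hta', mem_univ _⟩, ?_⟩
    rw [prod_inter_prod, univ_inter]
    have hsub : Icc a b' ∩ Ioi a' ⊆ Icc a' b' := fun s hs => ⟨le_of_lt hs.2, hs.1.2⟩
    refine (hv₂.mono hsub).congr fun z hz => ?_
    obtain ⟨s, w⟩ := z
    have hs : s ∈ Icc a b' ∩ Ioi a' := (mem_prod.1 hz).1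
    simp only [uncurry_apply_pair, h₂ s hs.1 hs.2]

omit [NormedAddCommGroup X] [NormedSpace ℝ X] in
/-- One-sided time derivatives of a glued field at times `t < b`: they are those of the left piece
within `[a, b]` (`b ≤ b'`). Whole-space twin of `FluidPDE.Torus.timeDerivWithin_glue_left`.
[cite: BealeKatoMajda1984, §1] -/
theorem timeDerivWithin_glue_left_Icc {a b b' : ℝ} {U v₁ : ℝ → X → F} (hbb' : b ≤ b')
    (h₁ : ∀ t ∈ Icc a b', t < b → U t = v₁ t) {t : ℝ} (ht : t ∈ Icc a b') (htb : t < b) (x : X) :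
    timeDerivWithin (Icc a b') U t x = timeDerivWithin (Icc a b) v₁ t x := by
  simp only [timeDerivWithin_apply]
  have hev : (fun τ => U τ x) =ᶠ[𝓝[Icc a b'] t] fun τ => v₁ τ x := by
    have h : ∀ᶠ τ in 𝓝[Icc a b'] t, τ ∈ Icc a b' ∧ τ < b :=
      (eventually_mem_nhdsWithin).and (mem_nhdsWithin_of_mem_nhds (Iio_mem_nhds htb))
    filter_upwards [h] with τ hτ
    rw [h₁ τ hτ.1 hτ.2]
  rw [hev.derivWithin_eq (by rw [h₁ t ht htb])]
  refine derivWithin_congr_set ?_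
  filter_upwards [Iio_mem_nhds htb] with τ hτ
  exact propext ⟨fun h => ⟨h.1, le_of_lt hτ⟩, fun h => ⟨h.1, (le_of_lt hτ).trans hbb'⟩⟩

omit [NormedAddCommGroup X] [NormedSpace ℝ X] in
/-- One-sided time derivatives of a glued field at times `t > a'`: they are those of the right piece
within `[a', b']` (`a ≤ a'`). Whole-space twin of `FluidPDE.Torus.timeDerivWithin_glue_right`.
[cite: BealeKatoMajda1984, §1] -/
theorem timeDerivWithin_glue_right_Icc {a a' b' : ℝ} {U v₂ : ℝ → X → F} (haa' : a ≤ a')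
    (h₂ : ∀ t ∈ Icc a b', a' < t → U t = v₂ t) {t : ℝ} (ht : t ∈ Icc a b') (hta : a' < t) (x : X) :
    timeDerivWithin (Icc a b') U t x = timeDerivWithin (Icc a' b') v₂ t x := by
  simp only [timeDerivWithin_apply]
  have hev : (fun τ => U τ x) =ᶠ[𝓝[Icc a b'] t] fun τ => v₂ τ x := by
    have h : ∀ᶠ τ in 𝓝[Icc a b'] t, τ ∈ Icc a b' ∧ a' < τ :=
      (eventually_mem_nhdsWithin).and (mem_nhdsWithin_of_mem_nhds (Ioi_mem_nhds hta))
    filter_upwards [h] with τ hτ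
    rw [h₂ τ hτ.1 hτ.2]
  rw [hev.derivWithin_eq (by rw [h₂ t ht hta])]
  refine derivWithin_congr_set ?_
  filter_upwards [Ioi_mem_nhds hta] with τ hτ
  exact propext ⟨fun h => ⟨le_of_lt hτ, h.2⟩, fun h => ⟨haa'.trans (le_of_lt hτ), h.2⟩⟩

variable {E : Type*} [NormedAddCommGroup E] [InnerProductSpace ℝ E] [FiniteDimensional ℝ E]

/-- **Gluing classical Navier–Stokes solutions on overlapping closed slabs.** Let `(u₁, p₁)` be a
classical solution (viscosity `ν`, force `f`) on `[a, b] × E` and `(u₂, p₂)` one on `[a', b'] × E`,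
with `a ≤ a' < m < b ≤ b'`, and suppose the two solutions AGREE (velocity and pressure) on the open
overlap `(a', b)`. Then the fields equal to `(u₁, p₁)` for `t ≤ m` and to `(u₂, p₂)` for `t > m` form
a classical solution on `[a, b'] × E`: joint smoothness is local in time
(`isSmoothSpaceTimeOn_glue_Icc`), and the one-sided time derivatives within `[a, b']` are those
within `[a, b]` at times `< b` and those within `[a', b']` at times `> a'`. Whole-space twin of the
accepted torus lemma `FunctionSpaces.Torus.IsClassicalNSSolutionOn.glue_Icc` (Robinson–Rodrigo–
Sadowski 2016, §8.1: restart, identify on the overlap, glue); unlike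
`IsClassicalNSSolutionOn.glue` (open overlap of a half-open slab, velocities only, pressures
renormalised) the pressures are glued AS THEY ARE. This is the continuation operation of
Beale–Kato–Majda 1984, §1 ("the solution can be continued in the class … to a larger interval")
for solutions given on closed slabs. [cite: BealeKatoMajda1984, §1] -/
theorem IsClassicalNSSolutionOn.glue_Icc {ν a b a' b' m : ℝ} {f u₁ u₂ : ℝ → E → E}
    {p₁ p₂ : ℝ → E → ℝ} (h₁ : IsClassicalNSSolutionOn (Icc a b) ν f u₁ p₁)
    (h₂ : IsClassicalNSSolutionOn (Icc a' b') ν f u₂ p₂) (haa' : a ≤ a') (ham : a' < m) (hmb : m < b)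
    (hbb' : b ≤ b') (heq : ∀ t ∈ Ioo a' b, u₁ t = u₂ t ∧ p₁ t = p₂ t) :
    IsClassicalNSSolutionOn (Icc a b') ν f (fun t => if t ≤ m then u₁ t else u₂ t)
      (fun t => if t ≤ m then p₁ t else p₂ t) := by
  have ha'b : a' < b := ham.trans hmb
  -- the glued fields agree with the pieces on the two relatively open parts
  have hU₁ : ∀ t ∈ Icc a b', t < b → (if t ≤ m then u₁ t else u₂ t) = u₁ t := by
    intro t _ htb
    by_cases htm : t ≤ m
    · rw [if_pos htm]
    · rw [if_neg htm, (heq t ⟨ham.trans (not_le.1 htm), htb⟩).1]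
  have hU₂ : ∀ t ∈ Icc a b', a' < t → (if t ≤ m then u₁ t else u₂ t) = u₂ t := by
    intro t _ hta
    by_cases htm : t ≤ m
    · rw [if_pos htm, (heq t ⟨hta, htm.trans_lt hmb⟩).1]
    · rw [if_neg htm]
  have hP₁ : ∀ t ∈ Icc a b', t < b → (if t ≤ m then p₁ t else p₂ t) = p₁ t := by
    intro t _ htb
    by_cases htm : t ≤ m
    · rw [if_pos htm]
    · rw [if_neg htm, (heq t ⟨ham.trans (not_le.1 htm), htb⟩).2]
  have hP₂ : ∀ t ∈ Icc a b', a' < t → (if t ≤ m then p₁ t else p₂ t) = p₂ t := by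
    intro t _ hta
    by_cases htm : t ≤ m
    · rw [if_pos htm, (heq t ⟨hta, htm.trans_lt hmb⟩).2]
    · rw [if_neg htm]
  refine ⟨isSmoothSpaceTimeOn_glue_Icc h₁.smooth_velocity h₂.smooth_velocity ha'b hU₁ hU₂,
    isSmoothSpaceTimeOn_glue_Icc h₁.smooth_pressure h₂.smooth_pressure ha'b hP₁ hP₂,
    fun t ht x => ?_, fun t ht => ?_⟩
  · by_cases htb : t < b
    · rw [timeDerivWithin_glue_left_Icc hbb' hU₁ ht htb x]
      simp only [hU₁ t ht htb, hP₁ t ht htb]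
      exact h₁.momentum t ⟨ht.1, htb.le⟩ x
    · have hta : a' < t := ha'b.trans_le (not_lt.1 htb)
      rw [timeDerivWithin_glue_right_Icc haa' hU₂ ht hta x]
      simp only [hU₂ t ht hta, hP₂ t ht hta]
      exact h₂.momentum t ⟨hta.le, ht.2⟩ x
  · by_cases htm : t ≤ m
    · simp only [if_pos htm]
      exact h₁.divFree t ⟨ht.1, htm.trans hmb.le⟩
    · simp only [if_neg htm]
      exact h₂.divFree t ⟨(ham.trans (not_le.1 htm)).le, ht.2⟩

end Glue

end Literature.Analysis.FluidPDE

end
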